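import Literature.AnabelianGeometry.EtaleTheta.DivisorMonoidsRootLaw
import Literature.AnabelianGeometry.EtaleTheta.Discharge.Sec4Prop42SubZetaALawFree

/-!
# [EtTh] Def. 4.1 (i) ERRATUM E2: approach (B)'s condition (d) DERIVED from approach (A)'s root law
# — the two printed remedies of [IUTchI] Rmk. 3.2.4 (iv) agree at the §4 canonical model

S. Mochizuki, *The étale theta function …*, Publ. RIMS **45** (2009) [MochizukiEtTh2009], §4 Def. 4.1 (i) p.86–87,
Prop. 4.2 (iii) proof p.89; ERRATUM E2 = [IUTchI] Rmk. 3.2.4 (kurims pp.75–76, read on the page): «(iv) The problem … may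
be remedied … via either of the following two approaches: (A) One may modify [EtTh], Definition 3.1, (ii), by taking the
definition of a "log-meromorphic" function to be a function that satisfies condition (a) ["for every `N ∈ ℕ_{≥1}`, `f`
admits an `N`-th root over some tempered covering", p.75] … (B) One may modify [EtTh], Definition 4.1, (i), by assuming that
the meromorphic function `f ∈ O^×(A^birat)` … satisfies … (d) For every `N ∈ ℕ_{≥1}`, there exists a linear morphism
`A′ → A` in `C` such that the pull-back of `f` to `A′` admits an `N`-th root» [cite: MochizukiEtTh2009, Def 4.1 (i) p.86].

abc-iut cell, layer L2; seat abc-iut-L2-t3 (gen 5), owner of Def. 4.1 / E2 (`BiKummerSetting.FractionPair.CondD` = condition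
(d), typed in `BiKummer.lean` with NO consumer until now).  PROOF-ONLY (0 defs); inputs BY NAME: this seat's
`FractionPair.CondD`, `TemperedFrobenioid.BaseRootLaw` / `rootLaw_of_baseRootLaw′` (p443354), `DivisorMonoids.RootLaw` /
`baseRootLaw_of_rootLaw` (p449939); abc-iut-L6-t12's `Prop42Sub.RootOverCovering` (sub-node L01a); abc-iut-w4-d044's
`exists_isPullback_over_baseHom` / abc-iut-w5-d134 lineage's `Prop42Sub.degFr_eq_one_of_isPullback`; nothing landed is
edited.
* §1 `BiKummerSetting.isLinear_of_isPullback` — a pull-back morphism of the §4 Frobenioid is linear ([FrdI] Thm. 5.2);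
  **`Prop42Sub.condD_Aodot_of_rootOverCovering`** — sub-node L01a (approach (A)'s output at `A_⊙`) ⇒ condition (d) for
  every `f ∈ O^×(A_⊙^birat)`.
* §2 **`Prop42Sub.condD_mkOfModelCanonical_of_ratFnRootLaw`** — at the canonical model, condition (d) at EVERY `IG`-object
  `A` from the `B`-level root law `hR` ALONE (no `μ_N`-saturation / refinement law: (d) asks only a LINEAR morphism):
  root over a base cover (`hR`) + the pull-back lift of [FrdI] Def. 1.2 (ii) (`exists_isPullback_over_baseHom`);
  `…_of_baseRootLaw` — the same from A10 `tf.BaseRootLaw IG` (+ `Φ` perfect, `hTF`); `…_of_dataRootLaw` — the same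
  from `DivisorMonoids.RootLaw` of the Def. 3.3 (iii) data + the lift of coverings along the base (p449939).
READING (neutral): in the tree the two printed remedies are now COMPARABLE in the kernel: (A) [tempered-meromorphic `B₀`,
binder `BaseRootLaw` / `DivisorMonoids.RootLaw`] ⇒ (B) [condition (d) on `f`]; the converse is not claimed.  By
F-L2t3g5-1 (p447056) neither is instantiable with non-trivial `B₀` inside the v1 `GaloisAction` class; both are at the
Kummer toy tower.  HONEST FRAMING: refereed pre-IUT material; typed ≠ proved — here proved (implications); nothing here
bears on the disputed [IUTchIII] Cor. 3.12.
-/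

noncomputable section

namespace Literature.AnabelianGeometry.EtaleTheta

open CategoryTheory Opposite Function Literature.AlgebraicGeometry.Frobenioids

universe u₀ v₀ u v w

variable {K : Type u₀} [Field K]

namespace BiKummerSetting

/-! ### §1 Condition (d) from sub-node L01a -/

section General

variable {X : SemiGraphs.TemperedArithmeticGroup.{u₀} K} {D₀ : Type u₀} [Category.{v₀} D₀]
  {V : FrdIMonoidStub.{w}} {T : RealifiedDivisorMonoids (D₀ := D₀) V} {D : Type u} [Category.{v} D]
  {VD : FrdICatStub.{u, v, w} D} (S : BiKummerSetting X T D VD)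

/-- **A pull-back morphism of the §4 Frobenioid is linear** (Frobenius degree `1`; [FrdI] Thm. 5.2 (ii) at the model,
abc-iut-w5-d134 lineage's law-free `degFr_eq_one_of_isPullback`). [cite: MochizukiFrdI2008, Thm. 5.2(ii) p.101] -/
theorem isLinear_of_isPullback {A B : S.C} {φ : A ⟶ B} (h : S.IsPullback φ) : S.IsLinear φ :=
  Prop42Sub.degFr_eq_one_of_isPullback S h

/-- **E2: approach (A)'s output implies approach (B)'s hypothesis at `A_⊙`** — sub-node L01a `RootOverCovering`
(«an `N`-th root of `f` over a pull-back covering `A' → A_⊙`», Prop. 4.2 (iii) proof p.89 under (A)) gives condition (d)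
of [IUTchI] Rmk. 3.2.4 (iv)(B) for every `f ∈ O^×(A_⊙^birat)` (a pull-back morphism is linear).
[cite: MochizukiEtTh2009, Def 4.1 (i) p.86] -/
theorem Prop42Sub.condD_Aodot_of_rootOverCovering
    (pullFrac : ∀ {A A' : S.C} (_ : A' ⟶ A), S.biratUnits A → S.biratUnits A')
    (h : Prop42Sub.RootOverCovering S pullFrac) (f : S.biratUnits S.Aodot) :
    FractionPair.CondD (f := f) (fun {_} φ x => pullFrac φ x) := fun N => by
  obtain ⟨A', φ, hpb, -, -, -, g, hg⟩ := h N f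
  exact ⟨A', φ, S.isLinear_of_isPullback hpb, g, hg⟩

end General

/-! ### §2 Condition (d) at the canonical model from the `B`-level / `B₀`-level / data-level root laws -/

section Canonical

variable (X : SemiGraphs.TemperedArithmeticGroup.{u₀} K) {D₀ : Type u₀}
  [Category.{v₀} D₀] {V : FrdIMonoidStub.{w}} {T : RealifiedDivisorMonoids (D₀ := D₀) V}
  {D : Type u} [Category.{v} D] {VD : FrdICatStub.{u, v, w} D}
  (tf : TemperedFrobenioid T D VD) (hZ : tf.monoidType = MonoidType.Z)
  (hP : ∀ A : Dᵒᵖ, IsPerfect (tf.Φ.carrier A)) (IG : D → Prop) (gS : ∀ A : D, IG A → (X.Pi →* Aut A))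
  (gSs : ∀ (A : D) (h : IG A), Function.Surjective (gS A h))
  (NH : Subgroup (Field.absoluteGaloisGroup K) → tf.category → ℕ+ → Prop) (A₀ : tf.category)
  (hA₀ : PreFrobenioid.IsFrobeniusTrivial tf.toElem A₀) (hA₀' : IG A₀.base)

/-- **Condition (d) at every `IG`-object of the canonical model from the `B`-level root law `hR` alone** (no
refinement / `μ_N`-saturation law — (d) asks only a LINEAR morphism): take a root of `f` over a base cover `A' → A^bs`
(`hR`) and lift the cover to a pull-back morphism `δ : W → A` of `C` ([FrdI] Def. 1.2 (ii); abc-iut-w4-d044's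
`exists_isPullback_over_baseHom`), which is linear. [cite: MochizukiEtTh2009, Def 4.1 (i) p.86] -/
theorem Prop42Sub.condD_mkOfModelCanonical_of_ratFnRootLaw
    (hΦd : Objectwise (fun M _ => IsDivisorial M) tf.divisorMonoid)
    (hR : ∀ (N : ℕ+) (A : D), IG A → ∀ f : tf.ratFnFunctor.obj (op A),
      ∃ (A' : D) (_ : IG A') (b : A' ⟶ A) (g : tf.ratFnFunctor.obj (op A')),
        g ^ (N : ℕ) = pull tf.ratFnFunctor b f)
    (A : (mkOfModelCanonical X tf hZ hP IG gS gSs NH A₀ hA₀ hA₀').C) (hA : IG A.base)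
    (f : (mkOfModelCanonical X tf hZ hP IG gS gSs NH A₀ hA₀ hA₀').biratUnits A) :
    FractionPair.CondD (f := f) (fun {_} φ x => tf.pullFracModel φ x) := fun N => by
  have hBg := tf.isGroupLike_ratFnFunctor T.isUnit_BΛ
  obtain ⟨A', -, b, g, hg⟩ :=
    hR N A.base hA ((show tf.biratUnitsModel A from f) : tf.ratFnFunctor.obj (op A.base))
  obtain ⟨W, δ, g', -, hδ, hg'⟩ :=
    (mkOfModelCanonical X tf hZ hP IG gS gSs NH A₀ hA₀ hA₀').exists_isPullback_over_baseHom hΦd hBg A b hg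
  exact ⟨W, δ, (mkOfModelCanonical X tf hZ hP IG gS gSs NH A₀ hA₀ hA₀').isLinear_of_isPullback hδ, g', hg'⟩

/-- **Condition (d) at every `IG`-object of the canonical model from A10 `BaseRootLaw`** (the `B₀^Λ`-level root law;
`Φ` perfect, `N`-th powers injective in `(Φ^{ℝ-log})^gp` — abc-iut-w4-d044's reduction `rootLaw_of_baseRootLaw`).
[cite: MochizukiEtTh2009, Def 4.1 (i) p.86] -/
theorem Prop42Sub.condD_mkOfModelCanonical_of_baseRootLaw
    (hΦd : Objectwise (fun M _ => IsDivisorial M) tf.divisorMonoid)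
    (hTF : ∀ (A : D) (N : ℕ), 0 < N →
      Function.Injective fun x : Algebra.GrothendieckGroup (T.ΦR.obj (op (tf.base.obj A))) => x ^ N)
    (hR₀ : tf.BaseRootLaw IG)
    (A : (mkOfModelCanonical X tf hZ hP IG gS gSs NH A₀ hA₀ hA₀').C) (hA : IG A.base)
    (f : (mkOfModelCanonical X tf hZ hP IG gS gSs NH A₀ hA₀ hA₀').biratUnits A) :
    FractionPair.CondD (f := f) (fun {_} φ x => tf.pullFracModel φ x) :=
  Prop42Sub.condD_mkOfModelCanonical_of_ratFnRootLaw X tf hZ hP IG gS gSs NH A₀ hA₀ hA₀' hΦd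
    (tf.rootLaw_of_baseRootLaw' IG hP hTF hR₀) A hA f

end Canonical

section CanonicalData

variable (X : SemiGraphs.TemperedArithmeticGroup.{u₀} K) {D₀ : Type u₀} [Category.{v₀} D₀]
  {dm : DivisorMonoids.{u₀, v₀, w} D₀} {hpf : ∀ Y : D₀ᵒᵖ, IsPerfFactorialCof (dm.Φ₀.obj Y)}
  {D : Type u} [Category.{v} D] {VD : FrdICatStub.{u, v, w} D}
  (tf : TemperedFrobenioid (RealifiedDivisorMonoids.ofRlfZWeak dm hpf) D VD)
  (hP : ∀ A : Dᵒᵖ, IsPerfect (tf.Φ.carrier A)) (IG : D → Prop) (gS : ∀ A : D, IG A → (X.Pi →* Aut A))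
  (gSs : ∀ (A : D) (h : IG A), Function.Surjective (gS A h))
  (NH : Subgroup (Field.absoluteGaloisGroup K) → tf.category → ℕ+ → Prop) (A₀ : tf.category)
  (hA₀ : PreFrobenioid.IsFrobeniusTrivial tf.toElem A₀) (hA₀' : IG A₀.base)

/-- **Condition (d) at every `IG`-object of the canonical model over type-`ℤ` Def. 3.6 (i) data, from E2 (a) on the
Def. 3.3 (iii) DATA** (`DivisorMonoids.RootLaw dm`, p449939) + the lift of coverings along the base + `Φ` perfect +
`hTF`. [cite: MochizukiEtTh2009, Def 4.1 (i) p.86] -/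
theorem Prop42Sub.condD_mkOfModelCanonical_of_dataRootLaw
    (hΦd : Objectwise (fun M _ => IsDivisorial M) tf.divisorMonoid)
    (hTF : ∀ (A : D) (N : ℕ), 0 < N →
      Function.Injective fun x : Algebra.GrothendieckGroup
        ((RealifiedDivisorMonoids.ofRlfZWeak dm hpf).ΦR.obj (op (tf.base.obj A))) => x ^ N)
    (hR : dm.RootLaw)
    (hLift : ∀ (A : D), IG A → ∀ (Y' : D₀) (f : Y' ⟶ tf.base.obj A),
      ∃ (A' : D) (_ : IG A') (c : A' ⟶ A) (g : tf.base.obj A' ⟶ Y'), g ≫ f = tf.base.map c)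
    (A : (mkOfModelCanonical X tf rfl hP IG gS gSs NH A₀ hA₀ hA₀').C) (hA : IG A.base)
    (f : (mkOfModelCanonical X tf rfl hP IG gS gSs NH A₀ hA₀ hA₀').biratUnits A) :
    FractionPair.CondD (f := f) (fun {_} φ x => tf.pullFracModel φ x) :=
  Prop42Sub.condD_mkOfModelCanonical_of_baseRootLaw X tf rfl hP IG gS gSs NH A₀ hA₀ hA₀' hΦd hTF
    (tf.baseRootLaw_of_rootLaw hR IG hLift) A hA f

end CanonicalData

end BiKummerSetting

end Literature.AnabelianGeometry.EtaleTheta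

end
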